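import Summits.NavierStokesRegularity.NavierStokesRegularity.Theorems.CertifiedBlowupCertifiedBlowupAxisymBlowupLifespanBound
import Literature.Analysis.FluidPDE.ConstantinDirectionDissipationProofs
import HarnessLib

/-!
# Leray's cap on the lifespan of every witness of the crux `CertifiedBlowupAxisymBlowup`

Theorems file landed `--supports stmt-NavierStokesRegularity-0727`, line `compact-amplification`
(continuation lead c4, wave S3 + S3b; registered stubs
`lifespan_upper_bound_of_isMaximalSmoothSolution` and
`leray_product_floor_of_isMaximalSmoothSolution`). A witness of the crux is a viscosity `ν > 0`, a
time `T > 0` and a maximal smooth solution `(u, p)` of the unforced Navier–Stokes system of lifespan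
`T`, Leray–Hopf on `[0, T]` from its rapidly decaying axisymmetric datum `u 0`. Leray 1934, §34
(eventual regularity: a turbulent solution is regular after a time `~ E₀² / ν⁵`) in the form of
Leray's enstrophy blow-up rate §20 (3.12) integrated in time against the energy inequality: the
LIFESPAN of every witness is CAPPED, `ν⁵ T ≤ C (∫ |u(0)|²)²`; multiplying with the landed lower
bound `c ν³ / T ≤ (∫ |∇u(0)|²)²` (`lifespan_lower_bound_of_isMaximalSmoothSolution`) gives the
scale-invariant LERAY PRODUCT FLOOR `(∫ |u(0)|²) (∫ |∇u(0)|²) ≥ c' ν⁴` on every blow-up datum. Both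
are tests every certified axisymmetric blow-up candidate `(ν, T, u₀)` must pass (route
CertifiedBlowup).

Proof of the cap: by `enstrophy_rate_of_isMaximalSmoothSolution`,
`∫ |∇u(τ)|² ≥ c₁ ν^{3/2} / √(T - τ) ≥ c₁ ν^{3/2} / √T` for `τ ∈ (0, T)`, so the dissipation through
the classical gradient is `∫₀ᵀ ∫ |∇u|² ≥ c₁ ν^{3/2} √T`; the Leray–Hopf energy inequality, whose
weak gradient agrees a.e. with the classical one
(`IsLerayHopfOn.lintegral_frobeniusNormSq_fderiv_of_classical`), gives
`ν ∫₀ᵀ ∫ |∇u|² ≤ ½ ∫ |u(0)|²`; squaring, `ν⁵ T ≤ (∫ |u(0)|²)² / (4 c₁²)`.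

No new definitions, no named-fact hypotheses, no `sorry`.

## References

* J. Leray, *Sur le mouvement d'un liquide visqueux emplissant l'espace*, Acta Math. 63 (1934),
  §20 (3.12) p. 225 and §34 p. 245 (eventual regularity). [Leray1934]
* J. C. Robinson, J. L. Rodrigo, W. Sadowski, *The Three-Dimensional Navier–Stokes Equations*,
  CUP 2016, Cor. 6.9, Thm. 8.13 (eventual regularity of Leray–Hopf solutions).
  [RobinsonRodrigoSadowski2016]
-/

-- the summit and its single problem share the name (D-0017 nested layout)
set_option linter.dupNamespace false

noncomputable section

open MeasureTheory Set Function Filter Topology Metric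
open scoped ENNReal NNReal

namespace Summit.NavierStokesRegularity.NavierStokesRegularity.Theorems.CertifiedBlowupAxisymBlowup.CompactAmplification

open Literature.Analysis Literature.Analysis.FluidPDE

/-- **Leray's cap on the lifespan of every witness** (registered stub of
stmt-NavierStokesRegularity-0727; Leray 1934, §34: eventual regularity after a time `~ E₀² / ν⁵`).
There is an absolute `C > 0` such that every maximal Leray–Hopf classical solution `(u, p)` of
viscosity `ν > 0` and finite lifespan `T > 0` from a rapidly decaying axisymmetric datum satisfies
`ν⁵ T ≤ C (∫ |u(0)|²)²` (in `[0, ∞]`). Proof: integrate the enstrophy blow-up rate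
`∫ |∇u(τ)|² ≥ c₁ ν^{3/2} / √(T - τ) ≥ c₁ ν^{3/2} / √T` (`enstrophy_rate_of_isMaximalSmoothSolution`)
over `τ ∈ (0, T)` and compare with the energy inequality `ν ∫₀ᵀ∫ |∇u|² ≤ ½ ∫ |u(0)|²`
(`IsLerayHopfOn.lintegral_frobeniusNormSq_fderiv_of_classical`): `c₁ ν^{5/2} √T ≤ ½ ∫ |u(0)|²`,
squared, with `C = 1 / (4 c₁²)`.
[cite: Leray1934, §34 p. 245 (eventual regularity) and §20 (3.12)] -/
theorem lifespan_upper_bound_of_isMaximalSmoothSolution : ∃ C : ℝ, 0 < C ∧ ∀ {ν T : ℝ} {u : ℝ → EuclideanSpace ℝ (Fin 3) → EuclideanSpace ℝ (Fin 3)} {p : ℝ → EuclideanSpace ℝ (Fin 3) → ℝ}, 0 < ν → 0 < T → IsMaximalSmoothSolution ν 0 u p T → IsLerayHopfOn T ν 0 (u 0) u → HasRapidSpatialDecay (u 0) → IsAxisymmetric (u 0) → ENNReal.ofReal (ν ^ 5 * T) ≤ ENNReal.ofReal C * (∫⁻ x, ‖u 0 x‖ₑ ^ 2) ^ 2 :=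 by
  obtain ⟨c₁, hc₁, h₁⟩ := enstrophy_rate_of_isMaximalSmoothSolution
  refine ⟨1 / (4 * c₁ ^ 2), by positivity, fun {ν T u p} hν hT hmax hLH hdec haxi => ?_⟩
  -- the dissipation through the classical gradient is finite and bounded by the initial energy
  obtain ⟨hDfin, hDle⟩ := hLH.lintegral_frobeniusNormSq_fderiv_of_classical hmax.1 hT
  set D : ℝ≥0∞ := ∫⁻ τ in Ioo 0 T, ∫⁻ x, ENNReal.ofReal (frobeniusNormSq (fderiv ℝ (u τ) x))
    with hD_def
  -- the enstrophy rate, integrated in time: `c₁ ν^{3/2} √T ≤ ∫₀ᵀ∫ |∇u|²`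
  have hA0 : 0 ≤ c₁ * ν ^ (3 / 2 : ℝ) := by positivity
  have hlow : ENNReal.ofReal (c₁ * ν ^ (3 / 2 : ℝ) * Real.sqrt T) ≤ D := by
    have hconst : ∫⁻ _ in Ioo (0 : ℝ) T, ENNReal.ofReal (c₁ * ν ^ (3 / 2 : ℝ) / Real.sqrt T) =
        ENNReal.ofReal (c₁ * ν ^ (3 / 2 : ℝ) * Real.sqrt T) := by
      rw [setLIntegral_const, Real.volume_Ioo, sub_zero,
        ← ENNReal.ofReal_mul (div_nonneg hA0 (Real.sqrt_nonneg T))]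
      congr 1
      rw [div_mul_eq_mul_div, mul_div_assoc, Real.div_sqrt]
    rw [← hconst, hD_def]
    refine setLIntegral_mono' measurableSet_Ioo fun τ hτ => ?_
    refine le_trans (ENNReal.ofReal_le_ofReal ?_) (h₁ hν hT hmax hLH hdec haxi τ ⟨hτ.1.le, hτ.2⟩)
    have hTτ : 0 < T - τ := sub_pos.2 hτ.2
    exact div_le_div_of_nonneg_left hA0 (Real.sqrt_pos.2 hTτ)
      (Real.sqrt_le_sqrt (by linarith [hτ.1]))
  -- in reals: `ν c₁ ν^{3/2} √T ≤ ν ∫₀ᵀ∫ |∇u|² ≤ ½ ∫ |u(0)|²`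
  have hreal : ν * (c₁ * ν ^ (3 / 2 : ℝ) * Real.sqrt T) ≤ VectorCalculus.kineticEnergy (u 0) := by
    have h : c₁ * ν ^ (3 / 2 : ℝ) * Real.sqrt T ≤ D.toReal :=
      (ENNReal.ofReal_le_iff_le_toReal hDfin).1 hlow
    exact (mul_le_mul_of_nonneg_left h hν.le).trans hDle
  -- squared: `c₁² ν⁵ T ≤ (½ ∫ |u(0)|²)²`
  have hK : 0 ≤ VectorCalculus.kineticEnergy (u 0) := kineticEnergy_nonneg _
  have hsq : c₁ ^ 2 * (ν ^ 5 * T) ≤ VectorCalculus.kineticEnergy (u 0) ^ 2 := by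
    have hL : 0 ≤ ν * (c₁ * ν ^ (3 / 2 : ℝ) * Real.sqrt T) := by positivity
    have h2 := pow_le_pow_left₀ hL hreal 2
    have h32 : (ν ^ (3 / 2 : ℝ)) ^ 2 = ν ^ 3 := by
      rw [← Real.rpow_two, ← Real.rpow_mul hν.le]
      norm_num
    have e : (ν * (c₁ * ν ^ (3 / 2 : ℝ) * Real.sqrt T)) ^ 2 = c₁ ^ 2 * (ν ^ 5 * T) := by
      rw [mul_pow, mul_pow, mul_pow, h32, Real.sq_sqrt hT.le]
      ring
    rwa [e] at h2
  -- the energy of the datum: `∫ ‖u 0‖ₑ² = ofReal (2 · kineticEnergy (u 0))`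
  have hE : ∫⁻ x, ‖u 0 x‖ₑ ^ 2 = ENNReal.ofReal (2 * VectorCalculus.kineticEnergy (u 0)) :=
    hLH.eEnergy_eq ⟨le_rfl, hT.le⟩
  rw [hE, ← ENNReal.ofReal_pow (by positivity), ← ENNReal.ofReal_mul (by positivity)]
  refine ENNReal.ofReal_le_ofReal ?_
  have e : 1 / (4 * c₁ ^ 2) * (2 * VectorCalculus.kineticEnergy (u 0)) ^ 2 =
      VectorCalculus.kineticEnergy (u 0) ^ 2 / c₁ ^ 2 := by
    field_simp
    ring
  rw [e, le_div_iff₀ (pow_pos hc₁ 2), mul_comm]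
  exact hsq

/-- **Leray's product floor on every blow-up datum** (registered stub of
stmt-NavierStokesRegularity-0727; Leray 1934, §34 with §20 (3.12)): there is an absolute `c > 0`
such that every maximal Leray–Hopf classical solution `(u, p)` of viscosity `ν > 0` and finite
lifespan `T > 0` from a rapidly decaying axisymmetric datum satisfies the scale-invariant bound
`c ν⁴ ≤ (∫ |u(0)|²) (∫ |∇u(0)|²)` (Frobenius enstrophy, in `[0, ∞]`). Proof: multiply the lifespan
cap `ν⁵ T ≤ C (∫ |u(0)|²)²` (`lifespan_upper_bound_of_isMaximalSmoothSolution`) with the lifespan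
floor `c₀ ν³ / T ≤ (∫ |∇u(0)|²)²` (`lifespan_lower_bound_of_isMaximalSmoothSolution`):
`(c₀ / C) ν⁸ ≤ ((∫ |u(0)|²) (∫ |∇u(0)|²))²`, and take square roots, `c = √(c₀ / C)`.
[cite: Leray1934, §34 p. 245 (eventual regularity) and §20 (3.12)] -/
theorem leray_product_floor_of_isMaximalSmoothSolution : ∃ c : ℝ, 0 < c ∧ ∀ {ν T : ℝ} {u : ℝ → EuclideanSpace ℝ (Fin 3) → EuclideanSpace ℝ (Fin 3)} {p : ℝ → EuclideanSpace ℝ (Fin 3) → ℝ}, 0 < ν → 0 < T → IsMaximalSmoothSolution ν 0 u p T → IsLerayHopfOn T ν 0 (u 0) u → HasRapidSpatialDecay (u 0) → IsAxisymmetric (u 0) → ENNReal.ofReal (c * ν ^ 4) ≤ (∫⁻ x, ‖u 0 x‖ₑ ^ 2) * ∫⁻ x, ENNReal.ofReal (frobeniusNormSq (fderiv ℝ (u 0) x)) := by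
  obtain ⟨C, hC, hup⟩ := lifespan_upper_bound_of_isMaximalSmoothSolution
  obtain ⟨c₀, hc₀, hlow⟩ := lifespan_lower_bound_of_isMaximalSmoothSolution
  refine ⟨Real.sqrt (c₀ / C), Real.sqrt_pos.2 (div_pos hc₀ hC),
    fun {ν T u p} hν hT hmax hLH hdec haxi => ?_⟩
  have h₁ := hup hν hT hmax hLH hdec haxi
  have h₂ := (hlow hν hT hmax hLH hdec haxi).1
  set E : ℝ≥0∞ := ∫⁻ x, ‖u 0 x‖ₑ ^ 2 with hE_def
  set Z : ℝ≥0∞ := ∫⁻ x, ENNReal.ofReal (frobeniusNormSq (fderiv ℝ (u 0) x)) with hZ_def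
  -- `ofReal (ν⁵ T / C) ≤ E²`
  have h₁' : ENNReal.ofReal (ν ^ 5 * T / C) ≤ E ^ 2 := by
    have h := mul_le_mul' (le_refl (ENNReal.ofReal (1 / C))) h₁
    rw [← mul_assoc, ← ENNReal.ofReal_mul (by positivity), ← ENNReal.ofReal_mul (by positivity),
      one_div_mul_cancel hC.ne', ENNReal.ofReal_one, one_mul] at h
    rwa [div_eq_inv_mul, ← one_div]
  -- the product: `ofReal ((c₀ / C) ν⁸) ≤ E² Z² = (E Z)²`
  have hprod : ENNReal.ofReal (Real.sqrt (c₀ / C) * ν ^ 4) ^ 2 ≤ (E * Z) ^ 2 := by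
    have h := mul_le_mul' h₁' h₂
    rw [← ENNReal.ofReal_mul (by positivity)] at h
    rw [mul_pow, ← ENNReal.ofReal_pow (by positivity)]
    refine le_trans (le_of_eq ?_) h
    congr 1
    rw [mul_pow, Real.sq_sqrt (div_pos hc₀ hC).le]
    field_simp
  exact (ENNReal.pow_le_pow_left_iff two_ne_zero).1 hprod

end Summit.NavierStokesRegularity.NavierStokesRegularity.Theorems.CertifiedBlowupAxisymBlowup.CompactAmplification

end
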